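import Literature.AlgebraicTopology.SingularHomology.FiniteCoverNorm
import Literature.AlgebraicTopology.SingularHomology.CohomologyRingChangeFunctoriality
import HarnessLib

/-!
# Deck transfer versus normalised transfer; composition of normalised transfers

Two bookkeeping identities between the transfers the tree carries for finite coverings, and one
consequence:

* **Galois comparison** (Part A). A finite regular (Galois) covering `c : FiniteDeckCover G E B` is in
  particular a finite covering (`FiniteDeckCover.isFiniteCover`), and its DECK transfer
  `τ_c` (`FiniteDeckCover.transferMap`, `(τ_c ψ)(σ) = ∑_{g ∈ G} ψ(g ∘ σ̃)`) is `|G|` times the NORMALISED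
  transfer `τ'` of the underlying finite covering (`IsFiniteCover.transferMap`,
  `(τ'ψ)(σ) = (#lifts σ)⁻¹ ∑_{σ̃ ↦ σ} ψ(σ̃)`): `FiniteDeckCover.card_smul_transferMap : |G| • τ' x = τ_c x`.
  (Average the orbit sum over the starting lift and swap the two sums; each deck transformation permutes
  the lifts — no freeness of the action on simplices is needed beyond what `FiniteDeckCover` records.)
* **Composition** (Part B). For finite coverings `q : E₂ → E₁`, `p : E₁ → B` with `q` of constant sheet
  number `d` (automatic over a connected `E₁`, `IsFiniteCover.exists_ncard_fibre_eq`):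
  `IsFiniteCover.transferMap_comp : τ'_{p ∘ q} = τ'_p ∘ τ'_q`, hence
  `IsFiniteCover.transferMap_eq_transferMap_comp_map : τ'_p = τ'_{p ∘ q} ∘ q^*`.
* **Bridge** (Part C). If the Galois cover factors as `c.proj = p₁ ∘ q`, then for any second map
  `p₂ : E₁ → B`: `|G| • (τ'_{p₁} ∘ p₂^*) = τ_c ∘ (p₂ ∘ q)^*` (`card_smul_transferMap_map_eq`), so the
  correspondence operator `τ'_{p₁} ∘ p₂^*` lies in every `ℚ`-subalgebra of `End Hⁿ(B; ℚ)` containing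
  `τ_c ∘ (p₂ ∘ q)^*` (`transferMap_comp_map_mem_of_deck`) — the form in which Hodge-compatibility of a
  deck-transfer operator on a Galois level cover (e.g. the tree's `UnitaryBallLevelDeckCover`) passes to the
  Hecke operator `τ'_{f₁} ∘ g^*` of a non-Galois Hecke pair.

Written for the Hecke correspondences of compact ball quotients (cell pub-hodgecm2, lane «L-BYPASS»; kernel
text by the seat pub-hodgecm2-s2crux-idea-2, probe `RA-v25`, gen 7; filed by b10).  Theorems only (plus the
structure-valued `FiniteDeckCover.isFiniteCover`); no named fact.

References: A. Hatcher, *Algebraic Topology* (2002), §3.G p. 321 (transfer), §1.3 Prop. 1.39 and p. 61,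
p. 70 (deck transformations of a normal covering act simply transitively on fibres; sheet number is locally
constant) [HatcherAT2002].
-/

open CategoryTheory

namespace Literature.AlgebraicTopology.SingularHomology

universe u v w

/-! ## Part A — Galois comparison `|G| • τ' = τ_c` -/

namespace FiniteDeckCover

variable {G : Type w} [Group G] [Fintype G] {E B : Type u} [TopologicalSpace E]
  [TopologicalSpace B] [MulAction G E] (c : FiniteDeckCover G E B) {n : ℕ}

/-- A finite regular covering is a finite covering (the fibre is one `G`-orbit).
[cite: HatcherAT2002, §1.3 Prop. 1.39] -/
theorem isFiniteCover : IsFiniteCover c.proj where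
  isCoveringMap := c.isCoveringMap_proj
  surjective := c.surjective_proj
  finite_fibre b := by
    obtain ⟨e₀, he₀⟩ := c.surjective_proj b
    refine (Set.finite_range fun g : G => g • e₀).subset fun e he => ?_
    rw [Set.mem_preimage, Set.mem_singleton_iff] at he
    obtain ⟨g, hg⟩ := c.exists_smul_of_proj_eq (e := e₀) (e' := e) (by rw [he, he₀])
    exact ⟨g, hg.symm⟩

/-- Deck transformations permute the lifts of a simplex. [cite: HatcherAT2002, §1.3 p. 70] -/
lemma map_deck_mem_liftsFinset {σ : SingularSimplex B n} {a : SingularSimplex E n}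
    (ha : a ∈ c.isFiniteCover.liftsFinset σ) (g : G) :
    a.map (c.deck g) ∈ c.isFiniteCover.liftsFinset σ := by
  rw [IsFiniteCover.mem_liftsFinset] at ha ⊢
  rw [c.map_deck_map_proj, ha]

/-- Re-indexing a sum over the lifts by a deck transformation. [cite: HatcherAT2002, §1.3 p. 70] -/
lemma sum_liftsFinset_map_deck {M : Type*} [AddCommMonoid M] (ψ : SingularSimplex E n → M)
    (σ : SingularSimplex B n) (g : G) :
    ∑ a ∈ c.isFiniteCover.liftsFinset σ, ψ (a.map (c.deck g)) =
      ∑ a ∈ c.isFiniteCover.liftsFinset σ, ψ a := by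
  refine Finset.sum_nbij' (fun a => a.map (c.deck g)) (fun a => a.map (c.deck g⁻¹))
    (fun a ha => c.map_deck_mem_liftsFinset ha g) (fun a ha => c.map_deck_mem_liftsFinset ha g⁻¹)
    (fun a _ => ?_) (fun a _ => ?_) (fun a _ => rfl)
  · rw [c.map_deck_map_deck, inv_mul_cancel, c.map_deck_one]
  · rw [c.map_deck_map_deck, mul_inv_cancel, c.map_deck_one]

variable {R : Type v} [CommRing R]

/-- **`#lifts · Σ_g ψ(g ∘ a) = |G| · Σ_{lifts} ψ`**: average the orbit sum over the starting lift
(it does not depend on it) and swap the sums; each deck transformation permutes the lifts.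
[cite: HatcherAT2002, §3.G p. 321] -/
theorem card_liftsFinset_mul_orbitSum (ψ : SingularSimplex E n → R) (a : SingularSimplex E n) :
    ((c.isFiniteCover.liftsFinset (a.map c.proj)).card : R) * c.orbitSum ψ a =
      (Fintype.card G : R) * ∑ a' ∈ c.isFiniteCover.liftsFinset (a.map c.proj), ψ a' := by
  have hconst : ∀ a'' ∈ c.isFiniteCover.liftsFinset (a.map c.proj),
      c.orbitSum ψ a'' = c.orbitSum ψ a := fun a'' ha'' =>
    c.orbitSum_eq_of_map_proj_eq ψ ((IsFiniteCover.mem_liftsFinset _).1 ha'')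
  calc ((c.isFiniteCover.liftsFinset (a.map c.proj)).card : R) * c.orbitSum ψ a
      = ∑ a'' ∈ c.isFiniteCover.liftsFinset (a.map c.proj), c.orbitSum ψ a'' := by
        rw [Finset.sum_congr rfl hconst, Finset.sum_const, nsmul_eq_mul]
    _ = ∑ g : G, ∑ a'' ∈ c.isFiniteCover.liftsFinset (a.map c.proj), ψ (a''.map (c.deck g)) := by
        simp only [orbitSum]
        rw [Finset.sum_comm]
    _ = ∑ g : G, ∑ a' ∈ c.isFiniteCover.liftsFinset (a.map c.proj), ψ a' :=
        Finset.sum_congr rfl fun g _ => c.sum_liftsFinset_map_deck ψ _ g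
    _ = (Fintype.card G : R) * ∑ a' ∈ c.isFiniteCover.liftsFinset (a.map c.proj), ψ a' := by
        rw [Finset.sum_const, Finset.card_univ, nsmul_eq_mul]

variable [Algebra ℚ R]

/-- **(R1-ii) on cochains: `τ_c ψ = |G| · τ' ψ`.** [cite: HatcherAT2002, §3.G p. 321] -/
theorem transferCochain_eq_card_mul (ψ : SingularSimplex E n → R) (σ : SingularSimplex B n) :
    c.transferCochain n ψ σ = (Fintype.card G : R) * c.isFiniteCover.transferCochain n ψ σ := by
  obtain ⟨a, ha⟩ := c.map_proj_surjective σ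
  dsimp only at ha
  subst ha
  rw [c.transferCochain_apply_map_proj, IsFiniteCover.transferCochain_apply]
  have hw := c.isFiniteCover.weight_mul_card (R := R) (a.map c.proj)
  have hk := c.card_liftsFinset_mul_orbitSum ψ a
  calc c.orbitSum ψ a
      = (c.isFiniteCover.weight (a.map c.proj) *
          ((c.isFiniteCover.liftsFinset (a.map c.proj)).card : R)) * c.orbitSum ψ a := by
        rw [hw, one_mul]
    _ = c.isFiniteCover.weight (a.map c.proj) *
          ((Fintype.card G : R) * ∑ a' ∈ c.isFiniteCover.liftsFinset (a.map c.proj), ψ a') := by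
        rw [mul_assoc, hk]
    _ = (Fintype.card G : R) * (c.isFiniteCover.weight (a.map c.proj) *
          ∑ a' ∈ c.isFiniteCover.liftsFinset (a.map c.proj), ψ a') := by ring

omit [Algebra ℚ R] in
/-- The cochain under `cyclesMap φ z` is `φ` of the cochain under `z`. [cite: HatcherAT2002, §3.G p. 321] -/
private lemma iCocycles_cyclesMap_hom (φ : singularCochainComplex R R E ⟶ singularCochainComplex R R B)
    (z : singularCochainComplex.cocycles R R E n) :
    singularCochainComplex.iCocycles R R B n (HomologicalComplex.cyclesMap φ n z) =
      φ.f n (singularCochainComplex.iCocycles R R E n z) := by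
  change (HomologicalComplex.cyclesMap φ _ ≫ singularCochainComplex.iCocycles R R B _) z =
    (singularCochainComplex.iCocycles R R E _ ≫ φ.f _) z
  rw [HomologicalComplex.cyclesMap_i]

/-- (R1-ii) on cocycles. [cite: HatcherAT2002, §3.G p. 321] -/
theorem card_smul_cyclesMap_transfer (z : singularCochainComplex.cocycles R R E n) :
    (Fintype.card G : R) • HomologicalComplex.cyclesMap (c.isFiniteCover.transfer (R := R)) n z =
      HomologicalComplex.cyclesMap (c.transfer (R := R)) n z := by
  refine singularCochainComplex.cocycles_ext ?_
  rw [map_smul, iCocycles_cyclesMap_hom, iCocycles_cyclesMap_hom]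
  funext σ
  change (Fintype.card G : R) * c.isFiniteCover.transferCochain n _ σ = c.transferCochain n _ σ
  exact (c.transferCochain_eq_card_mul _ σ).symm

/-- **(R1-ii) Galois comparison: `|G| • τ'^* x = τ_c^* x`** — the deck transfer of a finite regular
cover is `|G|` times the normalised transfer of the underlying finite covering.
[cite: HatcherAT2002, §3.G p. 321] -/
theorem card_smul_transferMap (x : singularCohomology R R E n) :
    (Fintype.card G : R) • c.isFiniteCover.transferMap n x = c.transferMap n x := by
  induction x using singularCohomology_induction_on with
  | h z =>
    rw [c.isFiniteCover.transferMap_π, transferMap_π c, ← c.card_smul_cyclesMap_transfer, map_smul]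

/-- Transported form (the projection given as a separate map). [cite: HatcherAT2002, §3.G p. 321] -/
theorem card_smul_transferMap' {proj' : C(E, B)} (h : c.proj = proj') (c' : IsFiniteCover proj')
    (x : singularCohomology R R E n) :
    (Fintype.card G : R) • c'.transferMap n x = c.transferMap n x := by
  subst h
  exact c.card_smul_transferMap x

end FiniteDeckCover

/-! ## Part B — composition of normalised transfers `τ'_{p∘q} = τ'_p ∘ τ'_q` -/

namespace IsFiniteCover

variable {E₂ E₁ B : Type u} [TopologicalSpace E₂] [TopologicalSpace E₁] [TopologicalSpace B]
  {q : C(E₂, E₁)} {p : C(E₁, B)} (cq : IsFiniteCover q) (cp : IsFiniteCover p)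
  (cpq : IsFiniteCover (p.comp q)) {n : ℕ}

/-- A lift through `p ∘ q` pushes down to a lift through `p`. [cite: HatcherAT2002, §3.G p. 321] -/
lemma map_mem_liftsFinset_of_mem_comp {σ : SingularSimplex B n} {b : SingularSimplex E₂ n}
    (hb : b ∈ cpq.liftsFinset σ) : b.map q ∈ cp.liftsFinset σ := by
  rw [mem_liftsFinset] at hb ⊢
  rw [← SingularSimplex.map_comp]
  exact hb

open scoped Classical in
/-- The lifts through `p ∘ q` over a given lift `a` through `p` are the lifts of `a` through `q`.
[cite: HatcherAT2002, §3.G p. 321] -/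
lemma filter_liftsFinset_comp {σ : SingularSimplex B n} {a : SingularSimplex E₁ n}
    (ha : a ∈ cp.liftsFinset σ) :
    (cpq.liftsFinset σ).filter (fun b => b.map q = a) = cq.liftsFinset a := by
  ext b
  rw [mem_liftsFinset] at ha
  rw [Finset.mem_filter, mem_liftsFinset, mem_liftsFinset]
  constructor
  · exact fun h => h.2
  · intro h
    refine ⟨?_, h⟩
    rw [SingularSimplex.map_comp, h, ha]

open scoped Classical in
/-- Summing over the lifts through `p ∘ q` = summing over lifts through `p`, then through `q`.
[cite: HatcherAT2002, §3.G p. 321] -/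
lemma sum_liftsFinset_comp {M : Type*} [AddCommMonoid M] (g : SingularSimplex E₂ n → M)
    (σ : SingularSimplex B n) :
    ∑ b ∈ cpq.liftsFinset σ, g b = ∑ a ∈ cp.liftsFinset σ, ∑ b ∈ cq.liftsFinset a, g b := by
  rw [← Finset.sum_fiberwise_of_maps_to (fun b hb => map_mem_liftsFinset_of_mem_comp cp cpq hb)]
  exact Finset.sum_congr rfl fun a ha => by rw [filter_liftsFinset_comp cq cp cpq ha]

include cq in
/-- Sheet numbers multiply: `#lifts_{p∘q} σ = #lifts_p σ · d` when `q` has `d` sheets everywhere.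
[cite: HatcherAT2002, §1.3 p. 61] -/
lemma card_liftsFinset_comp (d : ℕ) (hd : ∀ e, (q ⁻¹' {e}).ncard = d) (σ : SingularSimplex B n) :
    (cpq.liftsFinset σ).card = (cp.liftsFinset σ).card * d := by
  have h := sum_liftsFinset_comp cq cp cpq (fun _ => (1 : ℕ)) σ
  simp only [Finset.sum_const, smul_eq_mul, mul_one] at h
  rw [h, Finset.sum_congr rfl fun a _ => (cq.card_liftsFinset a).trans (hd _), Finset.sum_const,
    smul_eq_mul]

variable {R : Type v} [CommRing R] [Algebra ℚ R]

/-- The normalising weight of a `d`-sheeted covering is `1/d`. [cite: HatcherAT2002, §3.G p. 321] -/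
lemma weight_eq_of_ncard (d : ℕ) (hd : ∀ e, (q ⁻¹' {e}).ncard = d) (a : SingularSimplex E₁ n) :
    cq.weight (R := R) a = algebraMap ℚ R (d : ℚ)⁻¹ := by
  rw [weight, cq.card_liftsFinset, hd]

include cq in
/-- Normalising weights multiply along a composite of finite coverings. [cite: HatcherAT2002, §3.G p. 321] -/
lemma weight_comp (d : ℕ) (hd : ∀ e, (q ⁻¹' {e}).ncard = d) (σ : SingularSimplex B n) :
    cpq.weight (R := R) σ = cp.weight σ * algebraMap ℚ R (d : ℚ)⁻¹ := by
  rw [weight, weight, card_liftsFinset_comp cq cp cpq d hd σ, Nat.cast_mul, mul_inv, map_mul]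

/-- **(R1-i) on cochains: `τ'_{p∘q} = τ'_p ∘ τ'_q`** when `q` has constant sheet number.
[cite: HatcherAT2002, §3.G p. 321] -/
theorem transferCochain_comp (d : ℕ) (hd : ∀ e, (q ⁻¹' {e}).ncard = d)
    (ψ : SingularSimplex E₂ n → R) :
    cpq.transferCochain n ψ = cp.transferCochain n (cq.transferCochain n ψ) := by
  funext σ
  simp only [transferCochain_apply]
  rw [sum_liftsFinset_comp cq cp cpq, weight_comp cq cp cpq d hd σ, Finset.mul_sum, Finset.mul_sum]
  refine Finset.sum_congr rfl fun a _ => ?_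
  rw [weight_eq_of_ncard cq d hd a]
  ring

/-- (R1-i) on cochain complexes. [cite: HatcherAT2002, §3.G p. 321] -/
theorem transfer_comp (d : ℕ) (hd : ∀ e, (q ⁻¹' {e}).ncard = d) :
    cpq.transfer (R := R) = cq.transfer ≫ cp.transfer := by
  refine HomologicalComplex.hom_ext _ _ fun m => ?_
  rw [HomologicalComplex.comp_f]
  refine ModuleCat.hom_ext (LinearMap.ext fun ψ => ?_)
  change cpq.transferCochain m ψ = cp.transferCochain m (cq.transferCochain m ψ)
  exact transferCochain_comp cq cp cpq d hd ψ

/-- **(R1-i): `τ'_{p∘q}^* = τ'_p^* ∘ τ'_q^*`** on cohomology. [cite: HatcherAT2002, §3.G p. 321] -/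
theorem transferMap_comp (d : ℕ) (hd : ∀ e, (q ⁻¹' {e}).ncard = d)
    (x : singularCohomology R R E₂ n) :
    cpq.transferMap n x = cp.transferMap n (cq.transferMap n x) := by
  change HomologicalComplex.homologyMap cpq.transfer n x =
    (HomologicalComplex.homologyMap cq.transfer n ≫ HomologicalComplex.homologyMap cp.transfer n) x
  rw [← HomologicalComplex.homologyMap_comp, ← transfer_comp cq cp cpq d hd]

include cq in
/-- **`τ'_p^* = τ'_{p∘q}^* ∘ q^*`**: the transfer of `p` factors through the bigger cover.
[cite: HatcherAT2002, §3.G p. 321 and Prop. 3G.1] -/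
theorem transferMap_eq_transferMap_comp_map (d : ℕ) (hd : ∀ e, (q ⁻¹' {e}).ncard = d)
    (y : singularCohomology R R E₁ n) :
    cp.transferMap n y = cpq.transferMap n (singularCohomology.map R R q n y) := by
  rw [transferMap_comp cq cp cpq d hd, cq.transferMap_map]

include cq in
/-- Constant sheet number is automatic over a connected base. [cite: HatcherAT2002, §1.3 p. 61] -/
theorem exists_ncard_fibre_eq [PreconnectedSpace E₁] : ∃ d : ℕ, ∀ e, (q ⁻¹' {e}).ncard = d := by
  rcases isEmpty_or_nonempty E₁ with h | ⟨⟨e₀⟩⟩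
  · exact ⟨0, fun e => (IsEmpty.false e).elim⟩
  · exact ⟨(q ⁻¹' {e₀}).ncard, fun e => cq.ncard_fibre_eq e e₀⟩

end IsFiniteCover

/-! ## Part C — the (R1) bridge: `|G| • (τ'_{p₁} ∘ p₂^*) = τ_c ∘ (p₂ ∘ q)^*` -/

section Bridge

variable {G : Type w} [Group G] [Fintype G] {E₂ E₁ B : Type u} [TopologicalSpace E₂]
  [TopologicalSpace E₁] [TopologicalSpace B] [MulAction G E₂] {n : ℕ}
  {R : Type v} [CommRing R] [Algebra ℚ R]

/-- **(R1) bridge**: for a Galois cover `c : E₂ → B` factoring as `p₁ ∘ q` with `q` of constant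
sheet number, `|G| • τ'_{p₁}(p₂^* y) = τ_c((p₂ ∘ q)^* y)`. [cite: HatcherAT2002, §3.G p. 321] -/
theorem card_smul_transferMap_map_eq (c : FiniteDeckCover G E₂ B) {q : C(E₂, E₁)}
    {p₁ p₂ : C(E₁, B)} (cq : IsFiniteCover q) (cp : IsFiniteCover p₁) (hc : c.proj = p₁.comp q)
    (d : ℕ) (hd : ∀ e, (q ⁻¹' {e}).ncard = d) (y : singularCohomology R R B n) :
    (Fintype.card G : R) • cp.transferMap n (singularCohomology.map R R p₂ n y) =
      c.transferMap n (singularCohomology.map R R (p₂.comp q) n y) := by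
  have cpq : IsFiniteCover (p₁.comp q) := hc ▸ c.isFiniteCover
  rw [IsFiniteCover.transferMap_eq_transferMap_comp_map cq cp cpq d hd,
    c.card_smul_transferMap' hc cpq]
  congr 1
  change (singularCohomology.map R R p₂ n ≫ singularCohomology.map R R q n) y = _
  rw [← singularCohomology.map_comp]

/-- **(R1) membership transfer**: if `τ_c ∘ (p₂ ∘ q)^*` lies in a `ℚ`-subalgebra `A` of
`End Hⁿ(B; ℚ)` (e.g. the Hodge endomorphisms, for a deck-transfer operator of a Galois level cover), then so
does the Hecke-type operator `τ'_{p₁} ∘ p₂^*`.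
[cite: HatcherAT2002, §3.G p. 321] -/
theorem transferMap_comp_map_mem_of_deck
    (c : FiniteDeckCover G E₂ B) {q : C(E₂, E₁)} {p₁ p₂ : C(E₁, B)} (cq : IsFiniteCover q)
    (cp : IsFiniteCover p₁) (hc : c.proj = p₁.comp q) (d : ℕ) (hd : ∀ e, (q ⁻¹' {e}).ncard = d)
    {A : Subalgebra ℚ (Module.End ℚ (singularCohomology ℚ ℚ B n))}
    (hA : (c.transferMap (R := ℚ) n).hom ∘ₗ (singularCohomology.map ℚ ℚ (p₂.comp q) n).hom ∈ A) :
    (cp.transferMap (R := ℚ) n).hom ∘ₗ (singularCohomology.map ℚ ℚ p₂ n).hom ∈ A := by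
  have hG : (Fintype.card G : ℚ) ≠ 0 := Nat.cast_ne_zero.2 Fintype.card_ne_zero
  have key : (cp.transferMap (R := ℚ) n).hom ∘ₗ (singularCohomology.map ℚ ℚ p₂ n).hom =
      (Fintype.card G : ℚ)⁻¹ •
        ((c.transferMap (R := ℚ) n).hom ∘ₗ (singularCohomology.map ℚ ℚ (p₂.comp q) n).hom) := by
    refine LinearMap.ext fun y => ?_
    change cp.transferMap n (singularCohomology.map ℚ ℚ p₂ n y) =
      (Fintype.card G : ℚ)⁻¹ • c.transferMap n (singularCohomology.map ℚ ℚ (p₂.comp q) n y)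
    rw [← card_smul_transferMap_map_eq c cq cp hc d hd y, smul_smul, inv_mul_cancel₀ hG, one_smul]
  rw [key]
  exact A.smul_mem hA _

end Bridge

end Literature.AlgebraicTopology.SingularHomology
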